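import Summits.QuantumAdvantage.QuantumAdvantage.Theses.WeilTwice

/-!
# Crux `PriorBand` (route `WeilTwice`, item stmt-QuantumAdvantage-16536) — birth skeleton (BC3)

Line `birth`: the route's own foreseen first-layer split of the transferred theorem
`PriorBand` ("for all large n the level-n density of YES instances lies in [1/5 − 1/100, 1/2 + 1/100]"):

* `stub_local`    — the per-family band `LocalPriorBand` (route support item 16539, by name): for every
                     n-bit prime `p` and every coefficient vector `c` (h of degree 2g, g = ⌊√n⌋/3) with
                     nonempty good set, the fraction of good `u` with `3 ∣ #J(y² = h(x)(x−u))` is in the band.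
                     This is the analytic heart (Chebotarev–Deligne at ξ = 0 via Yu/Hall big mod-3 monodromy
                     + the Burnside/Witt orbit moments `SymplecticMoments`; its own split is the route's
                     second layer `TwistedChebotarev → SymplecticMoments → LocalPriorBand`).
* `stub_nonempty` — eventually every level has a valid instance (Bertrand: an n-bit prime p ≥ 5;
                     h = ∏_{i<2g}(X − i), u = 2g is squarefree since 2g + 1 ≤ p).
* `stub_encInj`   — the instance code `enc` is injective on valid instances (boolPair is a pairing,
                     `encodeNat` is injective, fixed-width little-endian bit blocks of width `p.size`
                     determine numbers `< p`), so `enc x ∈ L3 ↔ 3 ∣ #J` on valid `x` and `dens` is the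
                     true density.
* `stub_average`  — fibrewise averaging (mediant inequality): `S n` is the disjoint union over `(p, c)` of
                     the good sets (the map `(p, c, u) ↦ (p, ofFn c, u)` is injective and `Valid` on the
                     image is exactly good-set membership because `p.size = n` on `Ico 2^(n-1) 2^n`), so if
                     every nonempty fibre has YES-ratio in `[a, b]` then so does `dens n`.

`PriorBand_of` assembles them (sorry-free): take `n ≥ max n₀ n₁`.

The abbreviations `F jac Valid enc L3 S dens good ind dL` below are VERBATIM the `let`-bound terms of the
route decls `PriorBand` / `LocalPriorBand` (certified by `priorBand_iff` / `localPriorBand_iff`, both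
`Iff.rfl`), so provers may work with short names and convert by `Iff.rfl` / `exact`.
-/

noncomputable section

set_option linter.dupNamespace false

namespace Summit.QuantumAdvantage.QuantumAdvantage.Cruxes.PriorBand.Birth

open scoped BigOperators Classical
open Summit.QuantumAdvantage.QuantumAdvantage.Theses.WeilTwice

/-- The family polynomial `h(x)·(x − u)` over `𝔽_p`, `h = X^{|cs|} + Σ cs[i] X^i` (verbatim the route's `let F`). -/
abbrev F (p : ℕ) (cs : List ℕ) (u : ℕ) : Polynomial (ZMod p) :=
  ((Polynomial.X : Polynomial (ZMod p)) ^ cs.length + ∑ i ∈ Finset.range cs.length, Polynomial.C ((cs.getD i 0 : ℕ) : ZMod p) * Polynomial.X ^ i) * (Polynomial.X - Polynomial.C ((u : ℕ) : ZMod p))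

/-- The Mumford-pair count `#J(C_{h,u})(𝔽_p)` (verbatim the route's `let jac`). -/
abbrev jac (p g : ℕ) (cs : List ℕ) (u : ℕ) : ℕ :=
  Nat.card {w : Polynomial (ZMod p) × Polynomial (ZMod p) // w.1.Monic ∧ w.1.natDegree ≤ g ∧ w.2.degree < w.1.degree ∧ w.1 ∣ w.2 ^ 2 - F p cs u}

/-- Valid instances `⟨p, cs, u⟩` (verbatim the route's `let Valid`). -/
abbrev Valid (x : ℕ × List ℕ × ℕ) : Prop :=
  x.1.Prime ∧ 5 ≤ x.1 ∧ x.2.1.length = 2 * (Nat.sqrt x.1.size / 3) ∧ (∀ c ∈ x.2.1, c < x.1) ∧ x.2.2 < x.1 ∧ Squarefree (F x.1 x.2.1 x.2.2)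

/-- The instance code (verbatim the route's `let enc`). -/
abbrev enc (x : ℕ × List ℕ × ℕ) : List Bool :=
  Literature.Computability.Complexity.boolPair (Computability.encodeNat x.1) (Literature.Computability.Complexity.boolPair ((x.2.1.map fun c => List.ofFn fun i : Fin x.1.size => Nat.testBit c i).flatten) (List.ofFn fun i : Fin x.1.size => Nat.testBit x.2.2 i))

/-- The witness language `L3` (verbatim the route's `let L3`). -/
abbrev L3 : Language Bool :=
  enc '' {x | Valid x ∧ 3 ∣ jac x.1 (Nat.sqrt x.1.size / 3) x.2.1 x.2.2}

/-- The level-`n` instance set (verbatim the route's `let S`). -/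
abbrev S (n : ℕ) : Finset (ℕ × List ℕ × ℕ) :=
  (((Finset.Ico (2 ^ (n - 1)) (2 ^ n)).filter fun p => p.Prime ∧ 5 ≤ p).biUnion fun p => (Finset.univ : Finset ((Fin (2 * (Nat.sqrt n / 3)) → Fin p) × Fin p)).image fun cu => (p, List.ofFn (fun i => (cu.1 i : ℕ)), (cu.2 : ℕ))).filter Valid

/-- The level-`n` YES density (verbatim the route's `let dens`). -/
abbrev dens (n : ℕ) : ℝ :=
  (((S n).filter fun x => enc x ∈ L3).card : ℝ) / ((S n).card : ℝ)

/-- The good set `{u : h(x)(x−u) squarefree}` of the family `(p, c)` (verbatim `LocalPriorBand`'s `let good`). -/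
abbrev good (p g : ℕ) (c : Fin (2 * g) → Fin p) : Finset (Fin p) :=
  Finset.univ.filter fun u : Fin p => Squarefree (F p (List.ofFn fun i => (c i : ℕ)) u)

/-- The indicator of `3 ∣ #J` (verbatim `LocalPriorBand`'s `let ind`). -/
abbrev ind (p g : ℕ) (c : Fin (2 * g) → Fin p) (u : Fin p) : ℝ :=
  if 3 ∣ jac p g (List.ofFn fun i => (c i : ℕ)) u then 1 else 0

/-- The per-family YES density (verbatim `LocalPriorBand`'s `let dL`). -/
abbrev dL (p g : ℕ) (c : Fin (2 * g) → Fin p) : ℝ :=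
  (∑ u ∈ good p g c, ind p g c u) / ((good p g c).card : ℝ)

/-! ### Faithfulness of the abbreviations (definitional) -/

/-- The crux, restated over the abbreviations — definitionally (`Iff.rfl`). -/
theorem priorBand_iff :
    Summit.QuantumAdvantage.QuantumAdvantage.Theses.WeilTwice.PriorBand ↔
      ∃ n₀ : ℕ, ∀ n ≥ n₀, (S n).Nonempty ∧ (1 : ℝ) / 5 - 1 / 100 ≤ dens n ∧ dens n ≤ 1 / 2 + 1 / 100 :=
  Iff.rfl

/-- The support item `LocalPriorBand`, restated over the abbreviations — definitionally (`Iff.rfl`). -/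
theorem localPriorBand_iff :
    Summit.QuantumAdvantage.QuantumAdvantage.Theses.WeilTwice.LocalPriorBand ↔
      ∃ n₀ : ℕ, ∀ n ≥ n₀, ∀ p : ℕ, p.Prime → p.size = n → ∀ c : Fin (2 * (Nat.sqrt n / 3)) → Fin p,
        (good p (Nat.sqrt n / 3) c).Nonempty →
          (1 : ℝ) / 5 - 1 / 100 ≤ dL p (Nat.sqrt n / 3) c ∧ dL p (Nat.sqrt n / 3) c ≤ 1 / 2 + 1 / 100 :=
  Iff.rfl

/-! ### Registered stubs -/

/-- stub 1 (hardest, size L): the per-family prior `LocalPriorBand` (route support item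
stmt-QuantumAdvantage-16539, by name) — Chebotarev–Deligne at ξ = 0 for the mod-3 sheaf of the family
`y² = h(x)(x − u)` (Yu/Hall big monodromy, tame for p > 3^{2g}) + `SymplecticMoments` + `#good ≥ p − 2g − 1`;
second layer of the route: `TwistedChebotarev → SymplecticMoments → LocalPriorBand`. -/
theorem stub_local : Summit.QuantumAdvantage.QuantumAdvantage.Theses.WeilTwice.LocalPriorBand := by
  sorry

/-- stub 2 (size S/M): eventually every level `n` has a valid instance — Bertrand's postulate gives a prime
`p ∈ [2^(n-1), 2^n)` with `p ≥ 5` (n ≥ 3), and `h = ∏_{i<2g} (X − i)`, `u = 2g` give a squarefree `F`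
because `2g + 1 ≤ p` (g = ⌊√n⌋/3). -/
theorem stub_nonempty : ∃ n₁ : ℕ, ∀ n ≥ n₁, (S n).Nonempty := by
  sorry

/-- stub 3 (size M): the instance code is injective on valid instances (`boolPair_injective` twice,
`Computability.encodeNat` injective, and little-endian bit blocks of the fixed width `p.size` determine the
numbers `c_i, u < p < 2^{p.size}`; the block count is forced by `Valid`). Consequently `enc x ∈ L3 ↔ 3 ∣ #J`
for valid `x`. -/
theorem stub_encInj : Set.InjOn enc {x | Valid x} := by
  sorry

/-- stub 4 (size M): fibrewise averaging — the mediant step of `PriorBandOfLocal` at a fixed level `n`: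
`S n` is the disjoint union over `(p, c)` (p prime in `Ico 2^(n-1) 2^n`, so `p.size = n`) of the images of
the good sets under the injective map `(p, c, u) ↦ (p, ofFn c, u)`, on which `Valid` is exactly good-set
membership and (by injectivity of `enc` on valid instances) `enc x ∈ L3` is exactly `3 ∣ #J`; hence if every
nonempty fibre has YES-ratio in `[a, b]`, so has `dens n`. -/
theorem stub_average : ∀ (a b : ℝ) (n : ℕ), Set.InjOn enc {x | Valid x} →
    (∀ p : ℕ, p.Prime → p.size = n → ∀ c : Fin (2 * (Nat.sqrt n / 3)) → Fin p,
      (good p (Nat.sqrt n / 3) c).Nonempty → a ≤ dL p (Nat.sqrt n / 3) c ∧ dL p (Nat.sqrt n / 3) c ≤ b) →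
    (S n).Nonempty → a ≤ dens n ∧ dens n ≤ b := by
  sorry

/-! ### Name-keyed aliases of the stub statements — the hypotheses of `PriorBand_of`

The native skeleton audit (`#h21_check_skeleton`, run by `ledger skeleton check`) admits a hypothesis of the
composing theorem only if its head constant is a registered obligation (here: `LocalPriorBand`, the type of
`stub_local`) or is NAMED like a declared stub; `__Registered.stub_X` is the statement of `stub_X` under the
stub's short name (device of `Cruxes/EfficientAnchor/Lines/birth.lean`, `Cruxes/BQPNotSmall/Lines/birth.lean`).
Each alias is an `abbrev`, definitionally its statement. -/
namespace __Registered

/-- Alias of the statement of `stub_local` (the route item itself, by name). -/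
abbrev stub_local : Prop :=
  Summit.QuantumAdvantage.QuantumAdvantage.Theses.WeilTwice.LocalPriorBand
/-- Alias of the statement of `stub_nonempty`. -/
abbrev stub_nonempty : Prop :=
  ∃ n₁ : ℕ, ∀ n ≥ n₁, (S n).Nonempty
/-- Alias of the statement of `stub_encInj`. -/
abbrev stub_encInj : Prop :=
  Set.InjOn enc {x | Valid x}
/-- Alias of the statement of `stub_average`. -/
abbrev stub_average : Prop :=
  ∀ (a b : ℝ) (n : ℕ), Set.InjOn enc {x | Valid x} →
    (∀ p : ℕ, p.Prime → p.size = n → ∀ c : Fin (2 * (Nat.sqrt n / 3)) → Fin p,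
      (good p (Nat.sqrt n / 3) c).Nonempty → a ≤ dL p (Nat.sqrt n / 3) c ∧ dL p (Nat.sqrt n / 3) c ≤ b) →
    (S n).Nonempty → a ≤ dens n ∧ dens n ≤ b

end __Registered

/-! Registered-signature agreement: each stub theorem's signature is, definitionally, the alias it is keyed by
(`Iff.rfl`; only TYPES are compared, no `sorry` enters). -/
example : Summit.QuantumAdvantage.QuantumAdvantage.Theses.WeilTwice.LocalPriorBand ↔ __Registered.stub_local :=
  Iff.rfl
example : (∃ n₁ : ℕ, ∀ n ≥ n₁, (S n).Nonempty) ↔ __Registered.stub_nonempty := Iff.rfl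
example : Set.InjOn enc {x | Valid x} ↔ __Registered.stub_encInj := Iff.rfl
example : (∀ (a b : ℝ) (n : ℕ), Set.InjOn enc {x | Valid x} →
    (∀ p : ℕ, p.Prime → p.size = n → ∀ c : Fin (2 * (Nat.sqrt n / 3)) → Fin p,
      (good p (Nat.sqrt n / 3) c).Nonempty → a ≤ dL p (Nat.sqrt n / 3) c ∧ dL p (Nat.sqrt n / 3) c ≤ b) →
    (S n).Nonempty → a ≤ dens n ∧ dens n ≤ b) ↔ __Registered.stub_average := Iff.rfl

/-! ### The kernel-checked composition -/

/-- **THE SKELETON THEOREM.** `PriorBand` — concluded BY NAME — from the four declared stubs (no `sorry`):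
with `n₀` from `stub_local` and `n₁` from `stub_nonempty`, every `n ≥ max n₀ n₁` has `S n` nonempty and, by
`stub_average` fed with `stub_encInj` and the level-`n` instance of `stub_local`, density in the band
(`PriorBand` is definitionally `∃ n₀, ∀ n ≥ n₀, (S n).Nonempty ∧ band (dens n)`, see `priorBand_iff`). -/
theorem PriorBand_of :
    Summit.QuantumAdvantage.QuantumAdvantage.Theses.WeilTwice.LocalPriorBand →
    __Registered.stub_nonempty → __Registered.stub_encInj → __Registered.stub_average →
    Summit.QuantumAdvantage.QuantumAdvantage.Theses.WeilTwice.PriorBand := by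
  intro hL hN hI hA
  dsimp only [__Registered.stub_nonempty, __Registered.stub_encInj, __Registered.stub_average] at hN hI hA
  obtain ⟨n₀, hn₀⟩ := hL
  obtain ⟨n₁, hn₁⟩ := hN
  refine ⟨max n₀ n₁, fun n hn => ?_⟩
  have h₀ : n₀ ≤ n := le_trans (le_max_left _ _) hn
  have h₁ : n₁ ≤ n := le_trans (le_max_right _ _) hn
  exact ⟨hn₁ n h₁, hA _ _ n hI (hn₀ n h₀) (hn₁ n h₁)⟩

end Summit.QuantumAdvantage.QuantumAdvantage.Cruxes.PriorBand.Birth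

end
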